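import Summits.CriticalPhenomena.Ising3DConformalLimit.Theorems.MirrorHoelderCompactnessSeparableHoelderGradient
import Summits.CriticalPhenomena.Ising3DConformalLimit.Theorems.MirrorHoelderCompactnessSeparableHoelderMirrors
import Summits.CriticalPhenomena.Ising3DConformalLimit.Theorems.EnergyNotSigmaSquaredMoebiusLimitExistsMoveIneq
import Summits.CriticalPhenomena.Ising3DConformalLimit.Theorems.EnergyNotSigmaSquaredMoebiusLimitExistsLocallyBounded
import Literature.Probability.LatticeModels.TreeGraphWickPairInteraction
import HarnessLib

/-!
# The lattice Hölder estimate behind `SeparableHoelder`: one mirror-separated spin moved by a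
few lattice steps (route MirrorHoelderCompactness, helper for item stmt-CriticalPhenomena-6151)

Let `(Θ, φ)` be one of the nine lattice mirrors of `ℤ³` (the data produced by
`coordMirror` / `diagMirror` / `antiMirror` of `…SeparableHoelderMirrors`), `X, X'` two
configurations of `n' + 1` sites differing only at the index `i`, with the moving site in the
closed half `{φ ≤ 0}` before and after the move and all other sites in `{φ ≥ R}`, pairwise at
sup-distance `≥ R`. Write `G = criticalTwoPoint 3`, `g(n) = G(n e₀)`, `L = ‖X i - X' i‖₁`. Then
(`sq_criticalCorr_sub_le`)

  `(⟨∏σ_X⟩_{β_c} - ⟨∏σ_{X'}⟩_{β_c})² ≤ (2 · g(4q)/(4q+1) · L) · ((2n')! · g(R)^{n'})`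

as soon as `16q + 2L ≤ |φ (X i)|` (`q ≥ 1`). Ingredients:
* the RP–Cauchy–Schwarz move inequality `clusterMoveIneq_of_rp` (FILS 1978 §2) with the one-point
  cluster `{X i}`: the square is at most a three-term second difference of `G` at the doubled
  points `ΘX_i - X_i`, `ΘX'_i - X_i`, `ΘX'_i - X'_i` times the `2n'`-point function of the doubled
  block `ΘB ∪ B`;
* the all-direction gradient bound `abs_sub_le_ref_mul_l1Dist` (ADC 2021 Prop. 5.9 / DCP 2025
  (1.11) + Messager–Miracle-Solé) for the second difference (`bracket_bound`);
* Newman's Gaussian inequality `criticalCorr_le_pairingSum` and the Messager–Miracle-Solé sup-norm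
  comparison `twoPointFree_le_single_of_le` for the doubled block (`block_factor_bound`).

References: Fröhlich–Israel–Lieb–Simon 1978 §2; Aizenman–Duminil-Copin 2021 (arXiv:1912.07973)
Prop. 5.9 and §6.3; Duminil-Copin–Panis 2025 (arXiv:2404.05700) eq. (1.11); Messager–Miracle-Solé
1977; Newman 1975. No definitions are introduced.
-/

noncomputable section

open Finset
open scoped BigOperators

namespace Summit.CriticalPhenomena.Ising3DConformalLimit.MirrorHoelderCompactnessSeparableHoelder

open Literature.Probability.LatticeModels
open Summit.CriticalPhenomena.Ising3DConformalLimit.MoebiusLimitExistsOnlyInteraction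
  (clusterMoveIneq_of_rp criticalCorr_point_append_succAbove criticalCorr_le_pairingSum
    pairingSum_le_factorial_mul_pow)

/-! ### The critical two-point function on `ℤ³`: dictionary with the free state -/

/-- `m*(β_c) = 0` on `ℤ³` (Aizenman–Duminil-Copin–Sidoravicius 2015, in the tree). [cite: AizenmanDuminilCopinSidoraviciusCMP2015, Thm. 1.2 with Cor. 1.5 (1)] -/
theorem hm0_three : spontaneousMagnetization 3 (criticalBeta 3) = 0 :=
  spontaneousMagnetization_criticalBeta_eq_zero_holds (d := 3) le_rfl

/-- `⟨σ₀σ_x⟩^f_{β_c} = ⟨σ₀σ_x⟩⁺_{β_c} = criticalTwoPoint 3 x` on `ℤ³` (uniqueness at criticality, in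
the tree). [cite: FriedliVelenik2017, Thm. 3.28 and Remark 3.30] -/
theorem twoPointFree_three_eq (x : Site 3) :
    twoPointFree 3 (criticalBeta 3) x = criticalTwoPoint 3 x :=
  twoPointFree_criticalBeta_eq_criticalTwoPoint criticalCorr_wellDefined_holds le_rfl x

/-- **Increments of `criticalTwoPoint 3` at large sup-norm**: if `16q + ‖x - y‖_∞ ≤ ‖x‖_∞`
(`q ≥ 1`) then `|G(x) - G(y)| ≤ g(4q)/(4q+1) · ‖x - y‖₁`, `g(n) = G(n e₀)`.
[cite: AizenmanDuminilCopinAnnals2021, arXiv:1912.07973 Proposition 5.9] -/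
theorem abs_criticalTwoPoint_sub_le {q : ℕ} (hq : 1 ≤ q) {x y : Site 3}
    (hx : 16 * q + Site.supNorm (x - y) ≤ Site.supNorm x) :
    |criticalTwoPoint 3 x - criticalTwoPoint 3 y| ≤
      criticalTwoPoint 3 (Pi.single 0 ((4 * q : ℕ) : ℤ)) / (4 * (q : ℝ) + 1) * Site.l1Dist x y := by
  have h := abs_sub_le_ref_mul_l1Dist (criticalBeta_nonneg 3) hm0_three hq (0 : Fin 3) hx
  simpa only [twoPointFree_three_eq] using h

/-- **Sup-norm comparison for `criticalTwoPoint 3`** (Messager–Miracle-Solé): `G(y) ≤ g(s)` whenever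
`s ≤ ‖y‖_∞`. [cite: MessagerMiracleSoleJSP1977, main theorem (monotonicity of ⟨σ₀σ_x⟩ under reflections)] -/
theorem criticalTwoPoint_le_single_of_le {y : Site 3} {s : ℕ} (hs : s ≤ Site.supNorm y) :
    criticalTwoPoint 3 y ≤ criticalTwoPoint 3 (Pi.single 0 (s : ℤ)) := by
  have h := twoPointFree_le_single_of_le (criticalBeta_nonneg 3) (show 1 ≤ 3 by norm_num) hs
  rw [twoPointFree_three_eq, twoPointFree_three_eq] at h
  exact h

/-- The axis values of `criticalTwoPoint 3` are non-increasing on `ℕ` (Messager–Miracle-Solé).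
[cite: MessagerMiracleSoleJSP1977, main theorem (monotonicity of ⟨σ₀σ_x⟩ under reflections)] -/
theorem criticalTwoPoint_single_anti {a b : ℕ} (hab : a ≤ b) :
    criticalTwoPoint 3 (Pi.single 0 (b : ℤ)) ≤ criticalTwoPoint 3 (Pi.single 0 (a : ℤ)) := by
  obtain ⟨t, rfl⟩ : ∃ t, b = a + t := ⟨b - a, by omega⟩
  have h := twoPointFree_add_single_le (criticalBeta_nonneg 3) (Pi.single (0 : Fin 3) (a : ℤ)) 0
    (by simp) t
  rw [← Pi.single_add, twoPointFree_three_eq, twoPointFree_three_eq] at h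
  push_cast
  exact h

/-! ### `ℓ¹` bookkeeping -/

/-- `‖(a - c) - (b - c)‖₁ = ‖a - b‖₁`. [folklore] -/
theorem l1Dist_sub_sub_right {d : ℕ} (a b c : Site d) :
    Site.l1Dist (a - c) (b - c) = Site.l1Dist a b := by
  unfold Site.l1Dist
  refine Finset.sum_congr rfl fun k _ => ?_
  simp only [Pi.sub_apply]
  congr 1
  ring

/-- `‖(c - a) - (c - b)‖₁ = ‖a - b‖₁`. [folklore] -/
theorem l1Dist_sub_sub_left {d : ℕ} (a b c : Site d) :
    Site.l1Dist (c - a) (c - b) = Site.l1Dist a b := by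
  unfold Site.l1Dist
  refine Finset.sum_congr rfl fun k _ => ?_
  simp only [Pi.sub_apply]
  rw [show c k - a k - (c k - b k) = -(a k - b k) by ring, Int.natAbs_neg]

/-- `‖a - b‖₁ = ‖b - a‖₁`. [folklore] -/
theorem l1Dist_comm {d : ℕ} (a b : Site d) : Site.l1Dist a b = Site.l1Dist b a := by
  unfold Site.l1Dist
  refine Finset.sum_congr rfl fun k _ => ?_
  rw [show a k - b k = -(b k - a k) by ring, Int.natAbs_neg]

/-! ### The three-term second difference -/

/-- **Bound on the RP bracket.** For a mirror `Θ` that is an `ℓ¹` isometry with level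
`φ` satisfying `|φ v + φ v'| ≤ 2‖Θ v - v'‖_∞`, two sites `X, Y` with `16q + 2‖X - Y‖₁ ≤ |φ X|`
(`q ≥ 1`): `|G(ΘX - X) - 2G(ΘY - X) + G(ΘY - Y)| ≤ 2 · g(4q)/(4q+1) · ‖X - Y‖₁` — the three doubled
points have sup-norm `≥ |φ X| - 2‖X - Y‖₁ ≥ 16q` and consecutive ones are `‖X - Y‖₁` apart, so the
gradient bound `abs_criticalTwoPoint_sub_le` applies twice.
[cite: AizenmanDuminilCopinAnnals2021, arXiv:1912.07973 Proposition 5.9] -/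
theorem bracket_bound {Θ : Site 3 → Site 3} {φ : Site 3 → ℤ}
    (hl1 : ∀ v v', Site.l1Dist (Θ v) (Θ v') = Site.l1Dist v v')
    (hlev : ∀ v v', |φ v + φ v'| ≤ 2 * (Site.supNorm (Θ v - v') : ℤ))
    {q : ℕ} (hq : 1 ≤ q) {X Y : Site 3} (hM : 16 * q + 2 * Site.l1Dist X Y ≤ (φ X).natAbs) :
    |criticalTwoPoint 3 (Θ X - X) - 2 * criticalTwoPoint 3 (Θ Y - X) + criticalTwoPoint 3 (Θ Y - Y)| ≤
      2 * (criticalTwoPoint 3 (Pi.single 0 ((4 * q : ℕ) : ℤ)) / (4 * (q : ℝ) + 1)) * Site.l1Dist X Y := by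
  set P₀ : Site 3 := Θ X - X with hP₀
  set P₁ : Site 3 := Θ Y - X with hP₁
  set P₂ : Site 3 := Θ Y - Y with hP₂
  set L : ℕ := Site.l1Dist X Y with hL
  -- sup-norm of the first doubled point
  have h0 : (φ X).natAbs ≤ Site.supNorm P₀ := by
    have h := hlev X X
    have h' : |φ X| ≤ (Site.supNorm (Θ X - X) : ℤ) := by
      rw [show φ X + φ X = 2 * φ X by ring, abs_mul, abs_two] at h
      linarith
    rw [Int.abs_eq_natAbs] at h'
    exact_mod_cast h'
  -- distances between consecutive doubled points
  have hd01 : Site.l1Dist P₀ P₁ = L := by rw [hP₀, hP₁, l1Dist_sub_sub_right, hl1]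
  have hd12 : Site.l1Dist P₁ P₂ = L := by rw [hP₁, hP₂, l1Dist_sub_sub_left, hL, l1Dist_comm]
  have hs01 : Site.supNorm (P₀ - P₁) ≤ L := hd01 ▸ supNorm_sub_le_l1Dist P₀ P₁
  have hs12 : Site.supNorm (P₁ - P₂) ≤ L := hd12 ▸ supNorm_sub_le_l1Dist P₁ P₂
  have h1 : Site.supNorm P₀ ≤ Site.supNorm (P₀ - P₁) + Site.supNorm P₁ :=
    Site.supNorm_le_supNorm_sub_add P₀ P₁
  -- the two gradient bounds
  have hA := abs_criticalTwoPoint_sub_le hq (x := P₀) (y := P₁) (by omega)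
  have hB := abs_criticalTwoPoint_sub_le hq (x := P₁) (y := P₂) (by omega)
  rw [hd01] at hA
  rw [hd12] at hB
  have hsum : criticalTwoPoint 3 P₀ - 2 * criticalTwoPoint 3 P₁ + criticalTwoPoint 3 P₂ =
      (criticalTwoPoint 3 P₀ - criticalTwoPoint 3 P₁) - (criticalTwoPoint 3 P₁ - criticalTwoPoint 3 P₂) := by
    ring
  rw [hsum]
  refine (abs_sub _ _).trans ?_
  linarith

/-! ### The doubled block -/

/-- Reindexing the critical correlators along an equality of arities. [folklore] -/
theorem criticalCorr_cast {n n' : ℕ} (h : n = n') (Z : Fin n → Site 3) :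
    criticalCorr 3 n' (fun j => Z (Fin.cast h.symm j)) = criticalCorr 3 n Z := by
  subst h
  rfl

/-- **The doubled block is bounded by Newman's inequality.** If `2m` sites are pairwise at
sup-distance `≥ R` then `⟨∏ σ_{Z}⟩_{β_c} ≤ (2m)! · g(R)^m`: Newman's Gaussian inequality
`criticalCorr_le_pairingSum`, each pair entry `G(Z_p - Z_{p'}) ≤ g(R)` by the Messager–Miracle-Solé
sup-norm comparison, and `(2^m m!)⁻¹ Σ_τ ≤ (2m)!` (`pairingSum_le_factorial_mul_pow`, run on the
index-level kernel vanishing on the diagonal via `pairingSum_eq_pow_mul`).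
[cite: AizenmanDuminilCopinAnnals2021, arXiv:1912.07973 §6.3, first display, lower inequality (p. 26)] -/
theorem block_factor_bound (m : ℕ) (Z : Fin (2 * m) → Site 3) (R : ℕ)
    (hsep : ∀ p p', p ≠ p' → R ≤ Site.supNorm (Z p - Z p')) :
    criticalCorr 3 (2 * m) Z ≤ (2 * m).factorial * criticalTwoPoint 3 (Pi.single 0 (R : ℤ)) ^ m := by
  classical
  -- the index-level kernel, zero on the diagonal
  set T : Fin (2 * m) → Fin (2 * m) → ℝ := fun p p' =>
    if p = p' then 0 else criticalCorr 3 2 ![Z p, Z p'] with hT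
  have hTeq : pairingSum T m id = (1 : ℝ) ^ m * pairingSum (fun a b => criticalCorr 3 2 ![a, b]) m Z :=
    PairIsing.pairingSum_eq_pow_mul (fun a b => criticalCorr 3 2 ![a, b]) T 1 m Z id fun p p' hpp' => by
      simp only [hT, id_eq, if_neg hpp', one_mul]
  have hT0 : ∀ p p', 0 ≤ T p p' := fun p p' => by
    simp only [hT]
    split_ifs
    · exact le_rfl
    · exact criticalCorr_two_nonneg _ _
  have hTle : ∀ p p', T p p' ≤ criticalTwoPoint 3 (Pi.single 0 (R : ℤ)) := fun p p' => by
    simp only [hT]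
    split_ifs with hpp'
    · exact criticalTwoPoint_nonneg' _
    · rw [criticalCorr_two_pair]
      refine criticalTwoPoint_le_single_of_le ?_
      rw [Site.supNorm_sub_comm]
      exact hsep p p' hpp'
  calc criticalCorr 3 (2 * m) Z ≤ pairingSum (fun a b => criticalCorr 3 2 ![a, b]) m Z :=
        criticalCorr_le_pairingSum m Z
    _ = pairingSum T m id := by rw [hTeq, one_pow, one_mul]
    _ ≤ (2 * m).factorial * criticalTwoPoint 3 (Pi.single 0 (R : ℤ)) ^ m :=
        pairingSum_le_factorial_mul_pow hT0 hTle m id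

/-- **The doubled block of a mirror.** For a mirror `Θ` (sup-norm isometry, level `φ` with
`|φ v + φ v'| ≤ 2‖Θ v - v'‖_∞`) and a block `B` of `b` sites in `{φ ≥ R}` pairwise at sup-distance
`≥ R`, the `2b` sites `ΘB ∪ B` are pairwise at sup-distance `≥ R`, whence
`⟨∏σ_{ΘB} ∏σ_B⟩_{β_c} ≤ (2b)! · g(R)^b`. [cite: AizenmanDuminilCopinAnnals2021, arXiv:1912.07973 §6.3, first display, lower inequality (p. 26)] -/
theorem doubled_block_bound {Θ : Site 3 → Site 3} {φ : Site 3 → ℤ}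
    (hsup : ∀ v v', Site.supNorm (Θ v - Θ v') = Site.supNorm (v - v'))
    (hlev : ∀ v v', |φ v + φ v'| ≤ 2 * (Site.supNorm (Θ v - v') : ℤ))
    {b : ℕ} (B : Fin b → Site 3) (R : ℕ)
    (hsepB : ∀ j j', j ≠ j' → R ≤ Site.supNorm (B j - B j')) (hφB : ∀ j, (R : ℤ) ≤ φ (B j)) :
    criticalCorr 3 (b + b) (Fin.append (Θ ∘ B) B) ≤
      (2 * b).factorial * criticalTwoPoint 3 (Pi.single 0 (R : ℤ)) ^ b := by
  have hbb : b + b = 2 * b := by ring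
  rw [← criticalCorr_cast hbb (Fin.append (Θ ∘ B) B)]
  refine block_factor_bound b _ R fun p p' hpp' => ?_
  -- cross pairs are far apart because they lie on opposite sides of the mirror
  have hcross : ∀ j j', R ≤ Site.supNorm (Θ (B j) - B j') := fun j j' => by
    have h := hlev (B j) (B j')
    have h1 := hφB j
    have h2 := hφB j'
    have h3 : (R : ℤ) + R ≤ 2 * (Site.supNorm (Θ (B j) - B j') : ℤ) :=
      le_trans (by linarith) ((le_abs_self _).trans h)
    exact_mod_cast (show (R : ℤ) ≤ Site.supNorm (Θ (B j) - B j') by linarith)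
  set a := Fin.cast hbb.symm p with ha
  set a' := Fin.cast hbb.symm p' with ha'
  have haa' : a ≠ a' := fun h => hpp' (by
    have := congrArg (Fin.cast hbb) h
    simpa [ha, ha'] using this)
  show R ≤ Site.supNorm (Fin.append (Θ ∘ B) B a - Fin.append (Θ ∘ B) B a')
  clear_value a a'
  clear ha ha'
  induction a using Fin.addCases with
  | left j =>
    induction a' using Fin.addCases with
    | left j' =>
      simp only [Fin.append_left, Function.comp_apply]
      rw [hsup]
      exact hsepB j j' fun h => haa' (by rw [h])
    | right j' =>
      simp only [Fin.append_left, Fin.append_right, Function.comp_apply]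
      exact hcross j j'
  | right j =>
    induction a' using Fin.addCases with
    | left j' =>
      simp only [Fin.append_left, Fin.append_right, Function.comp_apply]
      rw [Site.supNorm_sub_comm]
      exact hcross j' j
    | right j' =>
      simp only [Fin.append_right]
      exact hsepB j j' fun h => haa' (by rw [h])

/-! ### The lattice Hölder estimate -/

/-- A pair entry of the Gram form: `⟨σ_a σ_{Θb}⟩_{β_c} = G(Θ b - a)`. [folklore] -/
theorem pair_entry (Θ : Site 3 → Site 3) (a b : Site 3) :
    criticalCorr 3 (1 + 1) (Fin.append ![a] (Θ ∘ ![b])) = criticalTwoPoint 3 (Θ b - a) := by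
  rw [← criticalCorr_two_pair]
  exact congrArg (criticalCorr 3 2) (by
    funext j
    fin_cases j
    · rfl
    · rfl)

/-- **THE LATTICE HÖLDER ESTIMATE.** Let `(Θ, φ)` be a lattice mirror of `ℤ³` — involution,
antisymmetric level, `criticalCorr 3` invariant and reflection positive on `{φ ≥ 0}`, `Θ` a sup-norm
and `ℓ¹` isometry with `|φ v + φ v'| ≤ 2‖Θ v - v'‖_∞` (the nine families of
`…SeparableHoelderMirrors`). Let `X, X'` be configurations of `n' + 1` sites that differ only at
`i`, with `φ (X i), φ (X' i) ≤ 0`, the other sites in `{φ ≥ R}` and pairwise at sup-distance `≥ R`,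
and `16q + 2‖X i - X' i‖₁ ≤ |φ (X i)|` (`q ≥ 1`). Then
`(⟨∏σ_X⟩ - ⟨∏σ_{X'}⟩)² ≤ (2 · g(4q)/(4q+1) · ‖X i - X' i‖₁) · ((2n')! · g(R)^{n'})`
(`g(n) = criticalTwoPoint 3 (n e₀)`): the RP–Cauchy–Schwarz move inequality
`clusterMoveIneq_of_rp` with the one-point cluster, `bracket_bound` and `doubled_block_bound`.
[cite: FrohlichEtAl1978, §2] -/
theorem sq_criticalCorr_sub_le {Θ : Site 3 → Site 3} {φ : Site 3 → ℤ}
    (hinv : ∀ v, Θ (Θ v) = v) (hφ : ∀ v, φ (Θ v) = -φ v)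
    (hsym : ∀ (n : ℕ) (y : Fin n → Site 3), criticalCorr 3 n (Θ ∘ y) = criticalCorr 3 n y)
    (hRP : ∀ (m : ℕ) (k : Fin m → ℕ) (z : (a : Fin m) → Fin (k a) → Site 3) (c : Fin m → ℝ),
      (∀ a j, 0 ≤ φ (z a j)) →
      0 ≤ ∑ a, ∑ b, c a * c b * criticalCorr 3 (k a + k b) (Fin.append (Θ ∘ z a) (z b)))
    (hsup : ∀ v v', Site.supNorm (Θ v - Θ v') = Site.supNorm (v - v'))
    (hl1 : ∀ v v', Site.l1Dist (Θ v) (Θ v') = Site.l1Dist v v')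
    (hlev : ∀ v v', |φ v + φ v'| ≤ 2 * (Site.supNorm (Θ v - v') : ℤ))
    {n' : ℕ} (i : Fin (n' + 1)) (X X' : Fin (n' + 1) → Site 3)
    (hdiff : ∀ j, j ≠ i → X' j = X j) (hXi : φ (X i) ≤ 0) (hX'i : φ (X' i) ≤ 0)
    (R : ℕ) (hφB : ∀ j, j ≠ i → (R : ℤ) ≤ φ (X j))
    (hsepB : ∀ j j', j ≠ i → j' ≠ i → j ≠ j' → R ≤ Site.supNorm (X j - X j'))
    {q : ℕ} (hq : 1 ≤ q) (hM : 16 * q + 2 * Site.l1Dist (X i) (X' i) ≤ (φ (X i)).natAbs) :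
    (criticalCorr 3 (n' + 1) X - criticalCorr 3 (n' + 1) X') ^ 2 ≤
      (2 * (criticalTwoPoint 3 (Pi.single 0 ((4 * q : ℕ) : ℤ)) / (4 * (q : ℝ) + 1)) *
          Site.l1Dist (X i) (X' i)) *
        ((2 * n').factorial * criticalTwoPoint 3 (Pi.single 0 (R : ℤ)) ^ n') := by
  -- the block of the other sites
  set B : Fin n' → Site 3 := fun j => X (i.succAbove j) with hBdef
  have hB' : (fun j => X' (i.succAbove j)) = B := funext fun j => hdiff _ (Fin.succAbove_ne i j)
  have hX : criticalCorr 3 (1 + n') (Fin.append ![X i] B) = criticalCorr 3 (n' + 1) X :=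
    criticalCorr_point_append_succAbove i X
  have hX' : criticalCorr 3 (1 + n') (Fin.append ![X' i] B) = criticalCorr 3 (n' + 1) X' := by
    rw [← hB']
    exact criticalCorr_point_append_succAbove i X'
  -- Cauchy–Schwarz for the Gram form
  have hCS := clusterMoveIneq_of_rp hinv hφ hsym hRP (a := 1) (b := n') (i := 0)
    (yA := ![X i]) (yA' := ![X' i]) (yB := B)
    (fun j hj => absurd (Subsingleton.elim j 0) hj)
    (fun j => by
      have : j = 0 := Subsingleton.elim j 0
      subst this
      simpa using hXi)
    (by simpa using hX'i)
    (fun j => le_trans (Int.natCast_nonneg R) (hφB _ (Fin.succAbove_ne i j)))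
  rw [hX, hX', pair_entry, pair_entry, pair_entry] at hCS
  -- the two factors
  have hbr := bracket_bound hl1 hlev hq (X := X i) (Y := X' i) hM
  have hblk := doubled_block_bound hsup hlev B R
    (fun j j' hjj' => hsepB _ _ (Fin.succAbove_ne i j) (Fin.succAbove_ne i j')
      fun h => hjj' (Fin.succAbove_right_injective h))
    (fun j => hφB _ (Fin.succAbove_ne i j))
  have hblk0 : 0 ≤ criticalCorr 3 (n' + n') (Fin.append (Θ ∘ B) B) :=
    Theorems.GapForcesFarMerging.Negative.criticalCorr_nonneg' _
  set A := criticalTwoPoint 3 (Θ (X i) - X i) - 2 * criticalTwoPoint 3 (Θ (X' i) - X i) +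
    criticalTwoPoint 3 (Θ (X' i) - X' i) with hA
  set Cb := criticalCorr 3 (n' + n') (Fin.append (Θ ∘ B) B) with hCb
  calc (criticalCorr 3 (n' + 1) X - criticalCorr 3 (n' + 1) X') ^ 2 ≤ A * Cb := hCS
    _ ≤ |A| * Cb := mul_le_mul_of_nonneg_right (le_abs_self A) hblk0
    _ ≤ (2 * (criticalTwoPoint 3 (Pi.single 0 ((4 * q : ℕ) : ℤ)) / (4 * (q : ℝ) + 1)) *
          Site.l1Dist (X i) (X' i)) *
        ((2 * n').factorial * criticalTwoPoint 3 (Pi.single 0 (R : ℤ)) ^ n') :=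
        mul_le_mul hbr hblk hblk0 (by
          have := criticalTwoPoint_nonneg' (d := 3) (Pi.single 0 ((4 * q : ℕ) : ℤ))
          positivity)


/-- **The lattice Hölder estimate, mirrored orientation**: the same bound when the moving site lies
in `{φ ≥ 0}` and the other sites in `{φ ≤ -R}` (apply `sq_criticalCorr_sub_le` to the level `-φ`,
reflection positivity on `{φ ≤ 0}` being `rp_nonpos_of_rp`). [cite: FrohlichEtAl1978, §2] -/
theorem sq_criticalCorr_sub_le' {Θ : Site 3 → Site 3} {φ : Site 3 → ℤ}
    (hinv : ∀ v, Θ (Θ v) = v) (hφ : ∀ v, φ (Θ v) = -φ v)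
    (hsym : ∀ (n : ℕ) (y : Fin n → Site 3), criticalCorr 3 n (Θ ∘ y) = criticalCorr 3 n y)
    (hRP : ∀ (m : ℕ) (k : Fin m → ℕ) (z : (a : Fin m) → Fin (k a) → Site 3) (c : Fin m → ℝ),
      (∀ a j, 0 ≤ φ (z a j)) →
      0 ≤ ∑ a, ∑ b, c a * c b * criticalCorr 3 (k a + k b) (Fin.append (Θ ∘ z a) (z b)))
    (hsup : ∀ v v', Site.supNorm (Θ v - Θ v') = Site.supNorm (v - v'))
    (hl1 : ∀ v v', Site.l1Dist (Θ v) (Θ v') = Site.l1Dist v v')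
    (hlev : ∀ v v', |φ v + φ v'| ≤ 2 * (Site.supNorm (Θ v - v') : ℤ))
    {n' : ℕ} (i : Fin (n' + 1)) (X X' : Fin (n' + 1) → Site 3)
    (hdiff : ∀ j, j ≠ i → X' j = X j) (hXi : 0 ≤ φ (X i)) (hX'i : 0 ≤ φ (X' i))
    (R : ℕ) (hφB : ∀ j, j ≠ i → φ (X j) ≤ -(R : ℤ))
    (hsepB : ∀ j j', j ≠ i → j' ≠ i → j ≠ j' → R ≤ Site.supNorm (X j - X j'))
    {q : ℕ} (hq : 1 ≤ q) (hM : 16 * q + 2 * Site.l1Dist (X i) (X' i) ≤ (φ (X i)).natAbs) :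
    (criticalCorr 3 (n' + 1) X - criticalCorr 3 (n' + 1) X') ^ 2 ≤
      (2 * (criticalTwoPoint 3 (Pi.single 0 ((4 * q : ℕ) : ℤ)) / (4 * (q : ℝ) + 1)) *
          Site.l1Dist (X i) (X' i)) *
        ((2 * n').factorial * criticalTwoPoint 3 (Pi.single 0 (R : ℤ)) ^ n') := by
  refine sq_criticalCorr_sub_le (φ := fun v => -φ v) hinv (fun v => by rw [hφ])
    hsym (fun m k z c hz => rp_nonpos_of_rp hinv hφ hsym hRP m k z c fun a j => by
      have := hz a j
      linarith) hsup hl1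
    (fun v v' => by
      rw [show -φ v + -φ v' = -(φ v + φ v') by ring, abs_neg]
      exact hlev v v')
    i X X' hdiff (by linarith) (by linarith) R
    (fun j hj => by linarith [hφB j hj]) hsepB hq ?_
  rw [Int.natAbs_neg]
  exact hM

end Summit.CriticalPhenomena.Ising3DConformalLimit.MirrorHoelderCompactnessSeparableHoelder

end
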